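import Literature.Topology.FourManifolds.BoundarySliceCharts
import Literature.Topology.FourManifolds.MorseChartChange
import Literature.Topology.FourManifolds.RegularLevelMorseData
import HarnessLib

/-!
# Critical points of a function restricted to a half-slice subset, at all points (boundary included)

Topic `Literature/Topology/FourManifolds`; infrastructure for the fact seat
`provefact-Literature.Topology.FourManifolds.exists_isBalancedGKTrisection` (Gay–Kirby 2016,
Thm. 4 via §4, Lemma 14).  Everything in this file is **proved**; no definitions, no named
facts.

For a subset `S` of a boundaryless manifold `M` carrying the manifold-with-boundary structure of
a boundary slice atlas `Φ` (`Literature.Topology.FourManifolds.BoundarySliceAtlas`,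
`BoundarySliceCharts.lean`; Lee 2013, Thm. 5.51), the companion file
`BoundarySliceMorseData.lean` reads the critical points of a restriction `F|S` at **interior**
points in an arbitrary ambient chart.  A Morse function *adapted to the boundary*
(`Literature.Topology.FourManifolds.IsMorseAdapted`) must moreover be **regular at the boundary
points**, where the derivative of the manifold with boundary is a derivative *within* the model
half-space.  This file supplies the reading valid at **every** point `p` of `S`, in the boundary
slice chart `Θ = (Φ.datum p).Θ` of the atlas itself:

* `BoundarySliceAtlas.isMCriticalPt_comp_val_iff_of_datum_eq` — **`p` is a critical point of
  `F|S` iff `D(F ∘ Θ⁻¹)(Θ p)` vanishes on the slice hyperplane `sliceInl (ℝᵏ⁺¹)`** (the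
  derivative within the half-space `{0 ≤ z₀}` of `(F ∘ Θ⁻¹) ∘ sliceInl` at `dropLast (Θ p)` is
  its ordinary derivative, by uniqueness of derivatives on the half-space,
  `ModelWithCorners.uniqueDiffOn`);
* `BoundarySliceAtlas.not_isMCriticalPt_comp_val_of_datum_eq` — in particular `p` is regular
  for `F|S` as soon as `D(F ∘ Θ⁻¹)(Θ p) (sliceInl u) ≠ 0` for some `u` (e.g. the inward normal
  `u = e₀` at a boundary point: Milnor 1965, Def. 3.1).

## References

* J. M. Lee, *Introduction to Smooth Manifolds* (2013), Thm. 5.51. [LeeSmoothManifolds2013]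
* J. Milnor, *Lectures on the h-cobordism theorem* (1965), Def. 3.1. [MilnorHCobordism1965]
* J. Milnor, *Morse theory* (1963), §2. [Milnor1963]
-/

open scoped Manifold ContDiff Topology
open Set Function Filter

noncomputable section

universe u

namespace Literature.Topology.FourManifolds

namespace BoundarySliceAtlas

variable {k : ℕ} {M : Type u} [TopologicalSpace M] [ChartedSpace (EuclideanSpace ℝ (Fin (k + 2))) M]
  [IsManifold (𝓡 (k + 2)) ∞ M] {S : Set M} (Φ : BoundarySliceAtlas k S)

/-- **Critical points of `F|S` read in the boundary slice chart of the atlas, at any point.**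
Let `S` carry the structure of the boundary slice atlas `Φ`, let `p ∈ S` (interior or boundary
point), `D = Φ.datum p` its chart, `Θ = D.Θ`, and let `F` be `C²` at `p`.  Then `p` is a
critical point of `F|S` iff `D(F ∘ Θ⁻¹)(Θ p) (sliceInl u) = 0` for all `u ∈ ℝᵏ⁺¹`.
[cite: LeeSmoothManifolds2013, Thm. 5.51] [cite: Milnor1963, §2] -/
theorem isMCriticalPt_comp_val_iff_of_datum_eq {F : M → ℝ} {p : S} {D : BoundarySliceChart k S}
    (hD : Φ.datum p = D) (hF : ContMDiffAt (𝓡 (k + 2)) 𝓘(ℝ, ℝ) 2 F p.1) :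
    letI := Φ.chartedSpace
    IsMCriticalPt (𝓡∂ (k + 1)) (F ∘ Subtype.val) p ↔
      ∀ u, fderiv ℝ (F ∘ D.Θ.symm) (D.Θ p.1) (sliceInl (k + 1) u) = 0 := by
  letI := Φ.chartedSpace
  haveI := Φ.isManifold
  subst hD
  set D := Φ.datum p with hDdef
  have hp : p.1 ∈ D.Θ.source := Φ.mem_source p
  have hΘ2 : D.Θ ∈ IsManifold.maximalAtlas (𝓡 (k + 2)) 2 M :=
    IsManifold.maximalAtlas_subset_of_le (by norm_cast) D.Θ_mem_maximalAtlas
  -- `F|S` is differentiable at `p`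
  have hval : ContMDiffAt (𝓡∂ (k + 1)) (𝓡 (k + 2)) ∞ (Subtype.val : S → M) p := Φ.contMDiff_subtype_val p
  have hFv : ContMDiffAt (𝓡∂ (k + 1)) 𝓘(ℝ, ℝ) 2 (F ∘ Subtype.val) p := hF.comp p (hval.of_le (by norm_cast))
  have hmd : MDifferentiableAt (𝓡∂ (k + 1)) 𝓘(ℝ, ℝ) (F ∘ Subtype.val) p := hFv.mdifferentiableAt (by norm_cast)
  -- the derivative is the derivative within the half-space of the written function
  unfold IsMCriticalPt
  rw [hmd.mfderiv, writtenInExtChartAt_eq_comp_extend_symm, Φ.chartAt_eq p]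
  have hext : extChartAt (𝓡∂ (k + 1)) p p = dropLast k (D.Θ p.1) := Φ.extChartAt_self_apply p
  rw [hext]
  set z₀ : EuclideanSpace ℝ (Fin (k + 1)) := dropLast k (D.Θ p.1) with hz₀
  have hz₀0 : 0 ≤ z₀ 0 := by rw [hz₀, dropLast_apply_zero]; exact D.apply_zero_nonneg hp p.2
  have hz₀mem : z₀ ∈ range (𝓡∂ (k + 1)) := by
    rw [range_modelWithCornersEuclideanHalfSpace]; exact hz₀0
  have hpt : sliceInl (k + 1) z₀ = D.Θ p.1 := by
    rw [sliceInl_apply, hz₀, D.snocEquiv_dropLast_apply hp p.2]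
  -- the written function agrees with `(F ∘ Θ⁻¹) ∘ sliceInl` on the half-space near `z₀`
  have hopen : IsOpen {z : EuclideanSpace ℝ (Fin (k + 1)) | snocEquiv (k + 1) (z, 0) ∈ D.Θ.target} :=
    D.Θ.open_target.preimage (contDiff_snocEquiv_zero (k + 1)).continuous
  have hz₀t : z₀ ∈ {z : EuclideanSpace ℝ (Fin (k + 1)) | snocEquiv (k + 1) (z, 0) ∈ D.Θ.target} := by
    show snocEquiv (k + 1) (z₀, 0) ∈ D.Θ.target
    rw [hz₀, D.snocEquiv_dropLast_apply hp p.2]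
    exact D.Θ.map_source hp
  have hev : ((F ∘ Subtype.val) ∘ ((D.chart p).extend (𝓡∂ (k + 1))).symm) =ᶠ[𝓝[range (𝓡∂ (k + 1))] z₀]
      ((F ∘ D.Θ.symm) ∘ sliceInl (k + 1)) := by
    filter_upwards [mem_nhdsWithin_of_mem_nhds (hopen.mem_nhds hz₀t), self_mem_nhdsWithin] with z hz hzr
    have hz0 : 0 ≤ z 0 := by rw [range_modelWithCornersEuclideanHalfSpace] at hzr; exact hzr
    simp only [comp_apply, sliceInl_apply]
    rw [D.coe_extend_chart_symm_of_mem hz0 hz]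
  have heq : ((F ∘ Subtype.val) ∘ ((D.chart p).extend (𝓡∂ (k + 1))).symm) z₀ =
      ((F ∘ D.Θ.symm) ∘ sliceInl (k + 1)) z₀ := by
    simp only [comp_apply, sliceInl_apply]
    rw [D.coe_extend_chart_symm_of_mem hz₀0 hz₀t]
  rw [hev.fderivWithin_eq heq]
  -- within-derivative = derivative (uniqueness on the half-space), then the chain rule
  have hFΘ : ContDiffAt ℝ 2 (F ∘ D.Θ.symm) (D.Θ p.1) := by
    have := contDiffAt_comp_extend_symm hF hΘ2 hp
    simpa [OpenPartialHomeomorph.extend_coe, OpenPartialHomeomorph.extend_coe_symm] using this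
  have hdiffΘ : DifferentiableAt ℝ (F ∘ D.Θ.symm) (sliceInl (k + 1) z₀) := by
    rw [hpt]; exact hFΘ.differentiableAt (by norm_num)
  have hdiff : DifferentiableAt ℝ ((F ∘ D.Θ.symm) ∘ sliceInl (k + 1)) z₀ :=
    hdiffΘ.comp z₀ (sliceInl (k + 1)).differentiableAt
  rw [hdiff.fderivWithin ((𝓡∂ (k + 1)).uniqueDiffOn z₀ hz₀mem),
    fderiv_comp z₀ hdiffΘ (sliceInl (k + 1)).differentiableAt, ContinuousLinearMap.fderiv, hpt]
  constructor
  · intro h u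
    exact congrArg (fun L : EuclideanSpace ℝ (Fin (k + 1)) →L[ℝ] ℝ => L u) h
  · intro h
    ext u
    exact h u

/-- **Regularity of `F|S` from one direction in the slice hyperplane**: if
`D(F ∘ Θ⁻¹)(Θ p) (sliceInl u) ≠ 0` for some `u` (at a boundary point: the inward normal
`u = e₀`), then `p` is not a critical point of `F|S`. [cite: MilnorHCobordism1965, Def. 3.1] [cite: LeeSmoothManifolds2013, Thm. 5.51] -/
theorem not_isMCriticalPt_comp_val_of_datum_eq {F : M → ℝ} {p : S} {D : BoundarySliceChart k S}
    (hD : Φ.datum p = D) (hF : ContMDiffAt (𝓡 (k + 2)) 𝓘(ℝ, ℝ) 2 F p.1) {u : EuclideanSpace ℝ (Fin (k + 1))}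
    (hu : fderiv ℝ (F ∘ D.Θ.symm) (D.Θ p.1) (sliceInl (k + 1) u) ≠ 0) :
    letI := Φ.chartedSpace
    ¬ IsMCriticalPt (𝓡∂ (k + 1)) (F ∘ Subtype.val) p := fun h =>
  hu ((Φ.isMCriticalPt_comp_val_iff_of_datum_eq hD hF).1 h u)

end BoundarySliceAtlas

end Literature.Topology.FourManifolds

end
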